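import Summits.ABC.StewartYu.PadicG3TwoBudgetK
import Summits.ABC.StewartYu.PadicG3TwoSizesThird
import HarnessLib

/-!
# Cell abc-stewartyu, Gen-3 frame at `p = 2` (crux `Y07Two`, stmt-ABC-19659), record: the THIRD-STEP BUDGET LINE
# (L3ᴿ) of the schedule of record `schedTwoS` — the gain branch of the Kummer `3`-descent's Liouville inequality

`Summits/ABC/StewartYu/PadicG3TwoBudgetT.lean` — cell `abc-stewartyu` (HOME `run/shared/lean/pub/abc-stewartyu/`),
route `PadicPrimesKummerThird`, seat p3 (g6, F-two lead).  Theorems only (real arithmetic).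

THE COMPARISON (unit `Z = G·X·L`).  At level `I < I*` the third step reads the family at `s/3`, `|s| ≤ 3·Xs3 (I+1)`,
`3 ∤ s`, orders `< T03 (I+1)`; its Liouville threshold is `(6·thirdDen·thirdM·P(all)⁵)^{3^{n+1}−1}` (degree of the
multicubic extension).  COST: `log Bw3 + (3^{n+1}−1)·(log 6 + log thirdDen + log thirdM + 5·hsum) ≤ 3^{n+1}·(91/10)·Z`
from p5's closed forms (`PadicG3TwoSizesThird`) and the `Z`-bounds of `PadicG3TwoBudgetZ/K` (the far height at
`|s| ≤ 3^{I+2}X` against the shrinking box `2nL/3^I`: `2|s|·hboxR I ≤ (9/2)Z`).  GAIN: `(2·Nfin I + 1)·t₃·G` with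
`Nfin I = 3^{d+3}·Xs3 I` (`kst = d + 3`) and `t₃ = Tfin I − T03 (I+1) ≥ (d+3)·T3 I/3`, so `≥ (247/36)·(d+3)·3^{n+1}·Z ≥
(247/12)·3^{n+1}·Z`.  Hence **`hL3_gain_schedTwoS`**.

WHAT THIS IS NOT: the `‖Λ₀‖`-branch (`PadicG3TwoFirstBranch`); no crux moves.

References: K. Yu, Acta Math. 211 (2013), Lemmas 5.3–5.4, (5.40)–(5.41), (5.58)–(5.70); Yu. V. Nesterenko, LNM
1819 (2003), §4.3, Cor. 4.5.
-/

noncomputable section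

open Finset Real
open Literature.NumberTheory.Transcendental
open Literature.NumberTheory.Transcendental.CW77 (heightProd)
open Literature.NumberTheory.Transcendental.CW77.Setup (Tau tauNorm)

namespace Summit.ABC.StewartYu

namespace TwoSetup

open Summit.ABC.StewartYu.G3Boxes Summit.ABC.StewartYu.PadicG3Par

variable (S : TwoSetup) (P : PadicG3Par (S.d + 1))

/-! ### The third-step multiplicity and gain -/

/-- **The third-step multiplicity**: `(d+3)·T3 I ≤ 3·(Tfin I − T0 (I+1))`. [cite: Yu2013, (5.58); shape only] -/
theorem t3_ge (I : ℕ) :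
    (S.d + 3) * S.T3 P I ≤ 3 * ((S.schedTwoS P).Tfin I - (S.schedTwoS P).T0 (I + 1)) := by
  rw [S.Tfin_schedTwoS_eq P I, schedTwoS_T0]
  unfold T03
  have h3 := S.T3_succ_le P I
  have h3' : 3 * S.T3 P (I + 1) ≤ S.T3 P I := (Nat.mul_le_mul_left 3 h3).trans (Nat.mul_div_le _ 3)
  generalize P.M / (S.d + 1 + 2) ^ 3 = M₃ at *
  generalize S.T3 P I = T at *
  generalize S.T3 P (I + 1) = T' at *
  have e : S.d + 1 + 2 = S.d + 3 := by omega
  rw [e]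
  have hsub : M₃ + (S.d + 3) * T + 1 - (M₃ + 2 * (S.d + 3) * T' + 1) = (S.d + 3) * T - 2 * (S.d + 3) * T' := by omega
  rw [hsub]
  have : 2 * (S.d + 3) * T' ≤ (S.d + 3) * T := by nlinarith
  zify [this]
  nlinarith

/-- **The third-step gain**: `(247/36)·(d+3)·3^{d+2}·Z ≤ (2·Nfin I + 1)·t₃·G` (`T3 I ≥ 8`).
[cite: Yu2013, (5.40)–(5.41); shape only] -/
theorem gain3_ge {I : ℕ} (hT8 : 8 ≤ S.T3 P I) :
    (247 / 36) * ((S.d : ℝ) + 3) * (3 : ℝ) ^ (S.d + 2) * (P.G * P.X * P.L) ≤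
      (((2 * (S.schedTwoS P).Nfin I + 1) * ((S.schedTwoS P).Tfin I - (S.schedTwoS P).T0 (I + 1)) : ℕ) : ℝ) * P.G := by
  have hGpos : 0 < P.G := by linarith [P.eight_le_G]
  have hXT := S.Xs3_mul_T3_ge P I hT8
  have ht := S.t3_ge P I
  set t : ℕ := (S.schedTwoS P).Tfin I - (S.schedTwoS P).T0 (I + 1) with htdef
  rw [schedTwoS_Nfin]
  have ht' : ((S.d : ℝ) + 3) * (S.T3 P I : ℝ) ≤ 3 * (t : ℝ) := by exact_mod_cast ht
  push_cast
  have h3 : (0 : ℝ) ≤ (3 : ℝ) ^ (S.d + 3) := by positivity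
  have hX0 : (0 : ℝ) ≤ (S.Xs3 P I : ℝ) := by positivity
  have ht0 : (0 : ℝ) ≤ (t : ℝ) := by positivity
  -- `(2·3^{d+3}·Xs + 1)·t ≥ 2·3^{d+3}·Xs·t ≥ 2·3^{d+3}·Xs·(d+3)·T3/3 = 2·3^{d+2}(d+3)·(Xs·T3)`
  have h32 : (0 : ℝ) ≤ (3 : ℝ) ^ (S.d + 2) := by positivity
  have h1 : 2 * (3 : ℝ) ^ (S.d + 2) * ((S.d : ℝ) + 3) * ((S.Xs3 P I : ℝ) * (S.T3 P I : ℝ)) ≤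
      (2 * (3 : ℝ) ^ (S.d + 3) * (S.Xs3 P I : ℝ) + 1) * (t : ℝ) := by
    have e3 : (3 : ℝ) ^ (S.d + 3) = 3 * (3 : ℝ) ^ (S.d + 2) := by rw [pow_succ]; ring
    calc 2 * (3 : ℝ) ^ (S.d + 2) * ((S.d : ℝ) + 3) * ((S.Xs3 P I : ℝ) * (S.T3 P I : ℝ))
        = 2 * (3 : ℝ) ^ (S.d + 2) * (S.Xs3 P I : ℝ) * (((S.d : ℝ) + 3) * (S.T3 P I : ℝ)) := by ring
      _ ≤ 2 * (3 : ℝ) ^ (S.d + 2) * (S.Xs3 P I : ℝ) * (3 * (t : ℝ)) :=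
          mul_le_mul_of_nonneg_left ht' (by positivity)
      _ = (2 * (3 : ℝ) ^ (S.d + 3) * (S.Xs3 P I : ℝ)) * (t : ℝ) := by rw [e3]; ring
      _ ≤ (2 * (3 : ℝ) ^ (S.d + 3) * (S.Xs3 P I : ℝ) + 1) * (t : ℝ) := by nlinarith
  have h2 : (247 / 36) * ((S.d : ℝ) + 3) * (3 : ℝ) ^ (S.d + 2) * (P.G * P.X * P.L) ≤
      2 * (3 : ℝ) ^ (S.d + 2) * ((S.d : ℝ) + 3) * ((S.Xs3 P I : ℝ) * (S.T3 P I : ℝ)) * P.G := by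
    have hd3 : (0 : ℝ) ≤ (S.d : ℝ) + 3 := by positivity
    have hc : (0 : ℝ) ≤ 2 * (3 : ℝ) ^ (S.d + 2) * ((S.d : ℝ) + 3) * P.G := by positivity
    have := mul_le_mul_of_nonneg_left hXT hc
    have e1 : 2 * (3 : ℝ) ^ (S.d + 2) * ((S.d : ℝ) + 3) * P.G * ((247 / 72) * P.X * P.L) =
        (247 / 36) * ((S.d : ℝ) + 3) * (3 : ℝ) ^ (S.d + 2) * (P.G * P.X * P.L) := by ring
    have e2 : 2 * (3 : ℝ) ^ (S.d + 2) * ((S.d : ℝ) + 3) * P.G * ((S.Xs3 P I : ℝ) * (S.T3 P I : ℝ)) =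
        2 * (3 : ℝ) ^ (S.d + 2) * ((S.d : ℝ) + 3) * ((S.Xs3 P I : ℝ) * (S.T3 P I : ℝ)) * P.G := by ring
    linarith
  have h3 := mul_le_mul_of_nonneg_right h1 hGpos.le
  linarith

/-! ### The per-degree cost -/

/-- `hsumS ≤ Z/1152` under the datum links. [folklore] -/
theorem hsumS_le_Z (hα : ∀ j, Height.logHeight₁ (S.α j) ≤ P.A (Fin.castSucc j))
    (hθ : Height.logHeight₁ S.θ ≤ P.A (Fin.last S.d)) : S.hsumS ≤ P.G * P.X * P.L / 1152 := by
  obtain ⟨hX36, hG8, hL25, hLG, hLL, hLH, hXL⟩ := S.base_facts P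
  set Z : ℝ := P.G * P.X * P.L with hZ
  set N1 : ℝ := (S.d : ℝ) + 1 + 1 with hN1
  have hd0 : (0 : ℝ) ≤ (S.d : ℝ) := by positivity
  have hN1' : 2 ≤ N1 := by rw [hN1]; linarith
  have hL0 : (0 : ℝ) ≤ P.L := by positivity
  have hNL : N1 * P.L ≤ Z / 576 := by
    have h1 : N1 * P.L * (288 * N1) ≤ Z := by
      have e : N1 * P.L * (288 * N1) = 288 * N1 ^ 2 * P.L := by ring
      rw [e]; exact hLL
    have h2 : N1 * P.L * 576 ≤ N1 * P.L * (288 * N1) := mul_le_mul_of_nonneg_left (by linarith) (by positivity)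
    rw [le_div_iff₀ (by norm_num)]; linarith
  have hAm := P.two_Amax_le_L
  have h1 : S.hsumS ≤ ((S.d : ℝ) + 1) * P.Amax := by
    unfold hsumS
    have hs : ∑ j, Height.logHeight₁ (S.α j) ≤ ∑ _j : Fin S.d, P.Amax :=
      Finset.sum_le_sum fun j _ => (hα j).trans (P.hAmax _)
    rw [Finset.sum_const, Finset.card_univ, Fintype.card_fin, nsmul_eq_mul] at hs
    have hθ' := hθ.trans (P.hAmax _)
    linarith
  have h2 : ((S.d : ℝ) + 1) * P.Amax ≤ ((S.d : ℝ) + 1) * (P.L / 2) :=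
    mul_le_mul_of_nonneg_left (by linarith) (by positivity)
  have h3 : ((S.d : ℝ) + 1) * (P.L / 2) ≤ N1 * P.L / 2 := by rw [hN1]; nlinarith
  linarith

/-- **The third point's far height**: `|s|·hboxR I ≤ (9/4)·Z` for `|s| ≤ 3·Xs3 (I+1)`. [cite: Yu2013, (5.35); shape only] -/
theorem sbox_le_Z (hα : ∀ j, Height.logHeight₁ (S.α j) ≤ P.A (Fin.castSucc j))
    (hθ : Height.logHeight₁ S.θ ≤ P.A (Fin.last S.d)) {I : ℕ} {s : ℤ}
    (hs : |s| ≤ ((3 * S.Xs3 P (I + 1) : ℕ) : ℤ)) :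
    |(s : ℝ)| ≤ (3 : ℝ) ^ (I + 2) * P.X ∧ |(s : ℝ)| * S.hboxR P I ≤ (9 / 4) * (P.G * P.X * P.L) := by
  obtain ⟨hX36, hG8, hL25, hLG, hLL, hLH, hXL⟩ := S.base_facts P
  have hL0 : (0 : ℝ) ≤ P.L := by positivity
  have hX0 : (0 : ℝ) ≤ P.X := by positivity
  have hs' : |(s : ℝ)| ≤ 3 * (S.Xs3 P (I + 1) : ℝ) := by
    have : ((|s| : ℤ) : ℝ) ≤ (((3 * S.Xs3 P (I + 1) : ℕ) : ℤ) : ℝ) := by exact_mod_cast hs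
    push_cast at this; exact this
  have hXs := (S.Xs3_lt P (I + 1)).le
  have hsX : |(s : ℝ)| ≤ (3 : ℝ) ^ (I + 2) * P.X := by
    calc |(s : ℝ)| ≤ 3 * ((3 : ℝ) ^ (I + 1) * P.X) := hs'.trans (mul_le_mul_of_nonneg_left hXs (by norm_num))
      _ = (3 : ℝ) ^ (I + 2) * P.X := by rw [pow_succ]; ring
  have hhR : S.hboxR P I ≤ 2 * ((S.d : ℝ) + 1) * P.L / (3 : ℝ) ^ I := by
    rcases Nat.eq_zero_or_pos I with rfl | hI1
    · rw [S.hboxR_zero P, pow_zero, div_one]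
      have := S.hbox0_le P hα hθ
      nlinarith
    · exact S.hboxR_le_L P hI1 hα hθ
  refine ⟨hsX, ?_⟩
  have hh0 := S.hboxR_nonneg P I
  have h3 : (0 : ℝ) < (3 : ℝ) ^ I := by positivity
  have hdN : 18 * ((S.d : ℝ) + 1) * (P.X * P.L) ≤ 18 * ((S.d : ℝ) + 1 + 1) * (P.X * P.L) :=
    mul_le_mul_of_nonneg_right (by linarith) (mul_nonneg hX0 hL0)
  calc |(s : ℝ)| * S.hboxR P I ≤ ((3 : ℝ) ^ (I + 2) * P.X) * (2 * ((S.d : ℝ) + 1) * P.L / (3 : ℝ) ^ I) :=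
        mul_le_mul hsX hhR hh0 (by positivity)
    _ = 18 * ((S.d : ℝ) + 1) * (P.X * P.L) := by rw [pow_add]; field_simp; ring
    _ ≤ (9 / 4) * (P.G * P.X * P.L) := by linarith


/-- **The per-degree cost of the third step**: for `I < I*`, `|s| ≤ 3·Xs3 (I+1)`, `tauNorm τ < T03 (I+1)`,
`log 6 + log thirdDen + log thirdM + 5·log P(all) ≤ (91/10)·Z`. [cite: Yu2013, Lemma 5.4 (5.58)–(5.70); shape only] -/
theorem cost3_le (hG : P.G = (P.m + 2) * Real.log 2) (hy : 2 * P.G ≤ P.yload) (hA1 : ∀ j, 1 ≤ P.A j)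
    (hα : ∀ j, Height.logHeight₁ (S.α j) ≤ P.A (Fin.castSucc j)) (hθ : Height.logHeight₁ S.θ ≤ P.A (Fin.last S.d))
    (hb : ∀ j, |(S.b j : ℝ)| ≤ Real.exp P.W) (hbθ : |(S.bθ : ℝ)| ≤ Real.exp P.W)
    {I : ℕ} (hI : I < S.Istar3 P) {s : ℤ}
    (hs : |s| ≤ ((3 * S.Xs3 P (I + 1) : ℕ) : ℤ)) {τ : Tau S.d} (hτ : tauNorm τ < S.T03 P (I + 1)) :
    Real.log 6 + Real.log (thirdDen (S.schedTwoS P) I s τ : ℝ) + Real.log (thirdM (S.schedTwoS P) I s τ) +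
        5 * Real.log (heightProd S.toQ.all) ≤ (91 / 10) * (P.G * P.X * P.L) := by
  obtain ⟨hX36, hG8, hL25, hLG, hLL, hLH, hXL⟩ := S.base_facts P
  obtain ⟨hGZ, hNZ, h1Z⟩ := S.smalls_le_Z P
  set Z : ℝ := P.G * P.X * P.L with hZ
  set N1 : ℝ := (S.d : ℝ) + 1 + 1 with hN1
  have hd0 : (0 : ℝ) ≤ (S.d : ℝ) := by positivity
  have hN1' : 2 ≤ N1 := by rw [hN1]; linarith
  have hGpos : 0 < P.G := by linarith [P.eight_le_G]
  have hL0 : (0 : ℝ) ≤ P.L := by positivity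
  have hX0 : (0 : ℝ) ≤ P.X := by positivity
  -- orders: `tauNorm τ ≤ T03 0`
  have hτ0 : tauNorm τ ≤ S.T03 P 0 := le_trans hτ.le (S.T03_le_T03_zero P (I + 1))
  have ht1 : τ.1 ≤ S.T03 P 0 := le_trans (by unfold tauNorm; omega) hτ0
  have ht1r : (τ.1 : ℝ) ≤ S.T03 P 0 := by exact_mod_cast ht1
  have ht2 : ((∑ j, τ.2 j : ℕ) : ℝ) ≤ S.T03 P 0 := by
    have : ∑ j, τ.2 j ≤ S.T03 P 0 := le_trans (by unfold tauNorm; omega) hτ0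
    exact_mod_cast this
  have hT := S.T03_zero_le P
  have h819 : 8 * ((S.d : ℝ) + 1) + 19 ≤ (27 / 2) * N1 := by rw [hN1]; linarith
  have hTN : (S.T03 P 0 : ℝ) ≤ (27 / 2) * N1 * P.L := by
    have := mul_le_mul_of_nonneg_right h819 hL0
    linarith
  have hhs : S.hsumS ≤ Z / 1152 := S.hsumS_le_Z P hα hθ
  have hNL : N1 * P.L ≤ Z / 576 := by
    have h1 : N1 * P.L * (288 * N1) ≤ Z := by
      have e : N1 * P.L * (288 * N1) = 288 * N1 ^ 2 * P.L := by ring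
      rw [e]; exact hLL
    have h2 : N1 * P.L * 576 ≤ N1 * P.L * (288 * N1) := mul_le_mul_of_nonneg_left (by linarith) (by positivity)
    rw [le_div_iff₀ (by norm_num)]; linarith
  obtain ⟨hsX, hsh⟩ := S.sbox_le_Z P hα hθ (I := I) hs
  -- (a) `log thirdDen ≤ t₀ log ν(H) + |t| log|b_θ| + (2/3)|s| hboxR + 2 hsum`
  have hDen := S.log_thirdDen_schedTwoS_le P I s τ
  have hν : (τ.1 : ℝ) * Real.log (Nat.lcmUpto P.H) ≤ (621 / 2560) * Z := by
    have hν' := NWPi.log_lcmUpto_le P.H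
    have hν0 : 0 ≤ Real.log (Nat.lcmUpto P.H) := Real.log_nonneg (by exact_mod_cast Nat.lcmUpto_pos P.H)
    calc (τ.1 : ℝ) * Real.log (Nat.lcmUpto P.H) ≤ (27 / 2) * N1 * P.L * (23 / 20 * (P.H : ℝ)) :=
          mul_le_mul (ht1r.trans hTN) hν' hν0 (by positivity)
      _ = (621 / 2560) * (64 * N1 * (P.L * P.H)) := by ring
      _ ≤ (621 / 2560) * Z := by linarith
  have hbW : ((∑ j, τ.2 j : ℕ) : ℝ) * Real.log (|(S.bθ : ℝ)|) ≤ (27 / 128) * Z := by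
    have hb1 : (1 : ℝ) ≤ |(S.bθ : ℝ)| := by
      have : (1 : ℤ) ≤ |S.bθ| := Int.one_le_abs S.bθ_ne
      have : ((1 : ℤ) : ℝ) ≤ ((|S.bθ| : ℤ) : ℝ) := by exact_mod_cast this
      push_cast at this; exact this
    have hlb : Real.log (|(S.bθ : ℝ)|) ≤ P.W := by
      have := Real.log_le_log (by linarith) hbθ
      rwa [Real.log_exp] at this
    have hlb0 : 0 ≤ Real.log (|(S.bθ : ℝ)|) := Real.log_nonneg hb1
    have hWL := P.W_add_log_le_WL
    have hlogL : 0 ≤ Real.log (2 * (P.L : ℝ)) := Real.log_nonneg (by linarith)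
    have hWle : P.W ≤ P.WL := by linarith
    have hWLm := P.WL_mul_le; push_cast at hWLm
    calc ((∑ j, τ.2 j : ℕ) : ℝ) * Real.log (|(S.bθ : ℝ)|) ≤ (27 / 2) * N1 * P.L * P.WL :=
          mul_le_mul (ht2.trans hTN) (hlb.trans hWle) hlb0 (by positivity)
      _ = (27 / 2) * (N1 * P.L * P.WL) := by ring
      _ ≤ (27 / 128) * Z := by rw [hN1]; linarith
  -- (b) `log thirdM ≤ …`
  have hM := S.log_thirdM_schedTwoS_le P I s τ
  have hc0 := S.log_cardB_le_lunk P hA1 0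
  have hcI := S.log_cardB_le_lunk P hA1 I
  have hlunk := P.lunk_le
  have hAmax := S.log_Amax3_le_Z P hG hy hA1 hα hθ hb hbθ
  have hlog3 := log_three_le
  have hlog2 := log_two_le
  have ht3 : (τ.1 : ℝ) * Real.log 3 ≤ (27 / 800) * Z := by
    have hlog3pos : 0 ≤ Real.log 3 := Real.log_nonneg (by norm_num)
    calc (τ.1 : ℝ) * Real.log 3 ≤ (27 / 2) * N1 * P.L * (6 / 5) := mul_le_mul (ht1r.trans hTN) hlog3 hlog3pos (by positivity)
      _ = (81 / 5) * (N1 * P.L) := by ring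
      _ ≤ (27 / 800) * Z := by linarith
  -- the Fel'dman size at level `I + 1`, point `|s| ≤ 3^{I+2} X ≤ 3^{I+2}·9H`
  have hF : Real.log (S.feldSize P (I + 1) |(s : ℝ)| τ.1) ≤ (7 / 5) * Z + P.G + 13 * N1 := by
    refine S.log_feldSize_le_Z P hG hy (I + 1) (abs_nonneg _) (k := 1) (by omega) ?_ ht1
    have hX9 := P.X_le_nine_H
    have hIle : I + 1 ≤ S.Istar3 P := hI
    have h3I : (0 : ℝ) ≤ (3 : ℝ) ^ (S.Istar3 P - (I + 1)) := by positivity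
    have h1 : |(s : ℝ)| ≤ (3 : ℝ) ^ (I + 2) * (9 * P.H) := hsX.trans (mul_le_mul_of_nonneg_left hX9 (by positivity))
    have e3 : (3 : ℝ) ^ (S.Istar3 P - (I + 1)) * (3 : ℝ) ^ (I + 2) = 3 * (3 : ℝ) ^ S.Istar3 P := by
      rw [← pow_add, show S.Istar3 P - (I + 1) + (I + 2) = S.Istar3 P + 1 by omega, pow_succ]; ring
    calc (3 : ℝ) ^ (S.Istar3 P - (I + 1)) * |(s : ℝ)| ≤ (3 : ℝ) ^ (S.Istar3 P - (I + 1)) * ((3 : ℝ) ^ (I + 2) * (9 * P.H)) :=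
          mul_le_mul_of_nonneg_left h1 h3I
      _ = 9 * (3 : ℝ) ^ S.Istar3 P * (3 : ℝ) ^ 1 * P.H := by
          rw [← mul_assoc, e3, pow_one]; ring
  have hXb : ((∑ j, τ.2 j : ℕ) : ℝ) * Real.log (S.Xb3R P I : ℝ) ≤ (5 / 16) * Z :=
    S.mul_log_Xb3R_le_Z P hA1 hb hbθ I ht2
  -- (c) `5 log P(all) = 5 hsum`, `log 6 ≤ 1.9`
  have hP5 : Real.log (heightProd S.toQ.all) = S.hsumS := S.log_heightProd_all
  have hlog6 : Real.log 6 ≤ 19 / 10 := by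
    rw [show (6 : ℝ) = 2 * 3 by norm_num, Real.log_mul (by norm_num) (by norm_num)]; linarith
  have hZ0 : 0 ≤ Z := by linarith
  rw [hP5]
  -- assemble
  linarith only [hDen, hν, hbW, hsh, hhs, hM, hc0, hcI, hlunk, hAmax, ht3, hF, hXb, hlog6, hlog2, hGZ, hNZ, h1Z, hZ0]

/-! ### The budget line -/

/-- **(L3ᴿ) THE THIRD-STEP GAIN BRANCH** of the schedule of record at every level `I < I*`.
[cite: Yu2013, Lemma 5.4 (5.58)–(5.70)] [cite: Nesterenko2003, §4.3, Cor 4.5] -/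
theorem hL3_gain_schedTwoS (hG : P.G = (P.m + 2) * Real.log 2) (hy : 2 * P.G ≤ P.yload)
    (hA1 : ∀ j, 1 ≤ P.A j)
    (hα : ∀ j, Height.logHeight₁ (S.α j) ≤ P.A (Fin.castSucc j)) (hθ : Height.logHeight₁ S.θ ≤ P.A (Fin.last S.d))
    (hb : ∀ j, |(S.b j : ℝ)| ≤ Real.exp P.W) (hbθ : |(S.bθ : ℝ)| ≤ Real.exp P.W)
    (hdepth : 8 * 3 ^ S.Istar3 P ≤ 4 * P.L) :
    ∀ I, I < S.Istar3 P → ∀ s : ℤ, |s| ≤ ((S.schedTwoS P).N0 (I + 1) : ℤ) → ¬ (3 : ℤ) ∣ s →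
      ∀ τ : Tau S.d, tauNorm τ < (S.schedTwoS P).T0 (I + 1) →
      (S.schedTwoS P).Bw I / (4 * (2 : ℝ) ^ (S.schedTwoS P).m) ^
          ((2 * (S.schedTwoS P).Nfin I + 1) * ((S.schedTwoS P).Tfin I - (S.schedTwoS P).T0 (I + 1))) <
        1 / (6 * (thirdDen (S.schedTwoS P) I s τ : ℝ) * thirdM (S.schedTwoS P) I s τ *
          heightProd S.toQ.all ^ 5) ^ (3 ^ (S.d + 1 + 1) - 1) := by
  intro I hI s hs _h3 τ hτ
  rw [schedTwoS_N0] at hs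
  rw [schedTwoS_T0] at hτ
  have hNs : S.Nsub3 P (I + 1) 0 = 3 * S.Xs3 P (I + 1) := by unfold Nsub3; simp
  rw [hNs] at hs
  rw [schedTwoS_Bw, schedTwoS_m]
  -- positivity of the threshold's factors
  have hD : (0 : ℝ) < (thirdDen (S.schedTwoS P) I s τ : ℝ) := by
    have : 1 ≤ thirdDen (S.schedTwoS P) I s τ := by
      unfold thirdDen
      refine one_le_mul (one_le_mul ?_ (Nat.one_le_pow _ _ (Int.natAbs_pos.mpr S.bθ_ne)))
        (MonomialDen.one_le_monDen _ S.toQ.all_ne _)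
      rw [schedTwoS_den₀]; exact Nat.one_le_pow _ _ (Nat.lcmUpto_pos P.H)
    exact_mod_cast this
  have hMpos : (0 : ℝ) < thirdM (S.schedTwoS P) I s τ := lt_of_lt_of_le one_pos (le_max_left _ _)
  have hPh : (0 : ℝ) < heightProd S.toQ.all := lt_of_lt_of_le one_pos (CW77.one_le_heightProd _)
  have hK : (0 : ℝ) < (6 * (thirdDen (S.schedTwoS P) I s τ : ℝ) * thirdM (S.schedTwoS P) I s τ *
      heightProd S.toQ.all ^ 5) ^ (3 ^ (S.d + 1 + 1) - 1) := by positivity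
  refine branch_gain_lt_of_log (S.Bw3_pos P) hK (by positivity) ?_
  rw [S.log_rho_eq_G P hG, log_thr_eq hD hMpos hPh]
  have hT8 : 8 ≤ S.T3 P I := S.T3_ge_of_depth P hdepth hI.le
  have hc := S.cost3_le P hG hy hA1 hα hθ hb hbθ hI hs hτ
  have hg := S.gain3_ge P hT8
  have hBw := S.log_Bw3_le_Z P hG hy
  obtain ⟨hGZ, hNZ, h1Z⟩ := S.smalls_le_Z P
  have hZ : (0 : ℝ) < P.G * P.X * P.L := by have := P.GXL_ge; linarith [show (0:ℝ) < 16*72*2^25 by positivity]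
  -- the degree weight `e = 3^{d+2} − 1 < 3^{d+2}`, and `d + 3 ≥ 3`
  have he : (((3 ^ (S.d + 1 + 1) - 1 : ℕ)) : ℝ) ≤ (3 : ℝ) ^ (S.d + 2) - 1 := by
    have h1 : 1 ≤ 3 ^ (S.d + 1 + 1) := Nat.one_le_pow _ _ (by norm_num)
    push_cast [Nat.cast_sub h1]
    exact le_of_eq (by ring)
  have he0 : (0 : ℝ) ≤ (((3 ^ (S.d + 1 + 1) - 1 : ℕ)) : ℝ) := by positivity
  have hd0 : (0 : ℝ) ≤ (S.d : ℝ) := by positivity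
  have hd3 : (3 : ℝ) ≤ (S.d : ℝ) + 3 := by linarith
  have h32 : (0 : ℝ) ≤ (3 : ℝ) ^ (S.d + 2) := by positivity
  -- cost ≤ (9/64 Z + G) + e·(179/20)Z ≤ 3^{d+2}·(179/20)Z < (247/12)·3^{d+2}·Z ≤ gain·G
  set C₁ : ℝ := Real.log 6 + Real.log (thirdDen (S.schedTwoS P) I s τ : ℝ) +
      Real.log (thirdM (S.schedTwoS P) I s τ) + 5 * Real.log (heightProd S.toQ.all) with hC₁
  set Z : ℝ := P.G * P.X * P.L with hZdef
  have h13 : (1 : ℝ) ≤ (3 : ℝ) ^ (S.d + 2) := one_le_pow₀ (by norm_num)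
  have hcost : Real.log (S.Bw3 P) + (((3 ^ (S.d + 1 + 1) - 1 : ℕ)) : ℝ) * C₁ ≤
      (3 : ℝ) ^ (S.d + 2) * ((91 / 10) * Z) := by
    have hBw' : Real.log (S.Bw3 P) ≤ (91 / 10) * Z := by linarith
    rcases le_or_gt 0 C₁ with hpos | hneg
    · have h1 : (((3 ^ (S.d + 1 + 1) - 1 : ℕ)) : ℝ) * C₁ ≤ ((3 : ℝ) ^ (S.d + 2) - 1) * ((91 / 10) * Z) :=
        mul_le_mul he hc hpos (by linarith)
      have e : ((3 : ℝ) ^ (S.d + 2) - 1) * ((91 / 10) * Z) = (3 : ℝ) ^ (S.d + 2) * ((91 / 10) * Z) - (91 / 10) * Z := by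
        ring
      linarith
    · have h1 : (((3 ^ (S.d + 1 + 1) - 1 : ℕ)) : ℝ) * C₁ ≤ 0 := mul_nonpos_of_nonneg_of_nonpos he0 hneg.le
      have h2 : (91 / 10) * Z ≤ (3 : ℝ) ^ (S.d + 2) * ((91 / 10) * Z) := by
        have := mul_le_mul_of_nonneg_right h13 (by positivity : (0:ℝ) ≤ (91 / 10) * Z)
        linarith
      linarith
  -- gain ≥ (247/36)(d+3)·3^{d+2}·Z ≥ (247/12)·3^{d+2}·Z > (179/20)·3^{d+2}·Z
  have hmono : 3 * ((3 : ℝ) ^ (S.d + 2) * Z) ≤ ((S.d : ℝ) + 3) * (3 : ℝ) ^ (S.d + 2) * Z := by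
    have := mul_nonneg (sub_nonneg.mpr hd3) (mul_nonneg h32 hZ.le)
    nlinarith
  have hpos : 0 < (3 : ℝ) ^ (S.d + 2) * Z := by positivity
  linarith

end TwoSetup

end Summit.ABC.StewartYu

end
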